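import Mathlib

/-! # Newton-child disc criterion (lens-1 I2, stub `newtonChild_mem_disc_iff`)

The Newton child `v − 1/K_v` lies in `v`'s own closed Jensen disc iff `Im K_ext ≤ 0`. -/

namespace RhW08.Lens1

open Complex
open scoped ComplexConjugate

/-- **NEWTON-CHILD CRITERION**: for `v = X + iy` and the EXTERNAL field `Kext` (everything except the
self-conjugate term `1/(v − v̄) = −i/(2y)`), the Newton child `v − 1/(Kext − i/(2y))` lies in `v`'s own
closed Jensen disc `D̄(X, y)` iff `Im Kext ≤ 0`.

The disc condition `‖child − X‖ ≤ y` reduces to `‖y·i − K⁻¹‖ ≤ y` where `K = Kext − i/(2y)`.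
Expanding: `a²/N² + (y + b/N)² ≤ y²` where `N = a² + b²`, `a = K.re`, `b = K.im`.
This simplifies to `(1 + 2yb)/N ≤ 0`, i.e. `1 + 2yb ≤ 0` since `N > 0`.
With `b = Kext.im − 1/(2y)`: `1 + 2y·Kext.im − 1 ≤ 0`, i.e. `Kext.im ≤ 0`. -/
theorem newtonChild_mem_disc_iff {X y : ℝ} (hy : 0 < y) {Kext : ℂ}
    (hK : Kext - I / (2 * (y : ℂ)) ≠ 0) :
    ‖((X : ℂ) + (y : ℂ) * I - (Kext - I / (2 * (y : ℂ)))⁻¹) - (X : ℂ)‖ ≤ y ↔ Kext.im ≤ 0 := by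
  set K := Kext - I / (2 * (y : ℂ)) with hK_def
  have hKne : K ≠ 0 := hK
  -- Child displacement is y·i - K⁻¹
  have hdispl : ((X : ℂ) + (y : ℂ) * I - K⁻¹) - (X : ℂ) = (y : ℂ) * I - K⁻¹ := by ring
  rw [hdispl]
  -- Key relationship between b = K.im and Kext.im
  have hbrel : K.im = Kext.im - 1 / (2 * y) := by
    simp only [hK_def, sub_im]
    have h2y_pos : (0 : ℝ) < 2 * y := by linarith
    have h2y_ne : (2 * y : ℝ) ≠ 0 := by linarith
    have h2yC_ne : (2 * (y : ℂ)) ≠ 0 := by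
      simp only [ne_eq, mul_eq_zero, OfNat.ofNat_ne_zero, ofReal_eq_zero, not_or, not_false_eq_true]
      constructor
      · norm_num
      · linarith
    rw [div_im]
    simp only [I_im, I_re, mul_re, ofReal_re, ofReal_im, mul_zero, sub_zero,
               normSq_mul, normSq_ofReal]
    have hnorm2 : normSq (2 : ℂ) = 4 := by norm_num [normSq]
    have hre2 : (2 : ℂ).re = 2 := by norm_num
    rw [hnorm2, hre2]
    -- Goal: Kext.im - (1 * (2 * y) / (4 * (y * y)) - 0 * (2 * ↑y).im / (4 * (y * y))) = Kext.im - 1 / (2 * y)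
    simp only [zero_mul, one_mul]
    have h4y2_pos : (0 : ℝ) < 4 * y * y := by nlinarith
    field_simp
    ring
  -- Setup for the algebraic calculation
  set a := K.re
  set b := K.im
  have hnormSq_pos : 0 < normSq K := normSq_pos.mpr hKne
  have hnormSq_eq : normSq K = a ^ 2 + b ^ 2 := by rw [normSq_apply]; ring
  have hN_pos : 0 < a ^ 2 + b ^ 2 := by rw [← hnormSq_eq]; exact hnormSq_pos
  -- Express the norm condition algebraically
  -- ‖y·i - K⁻¹‖² = normSq(y·i - K⁻¹)
  -- = (−K⁻¹.re)² + (y − K⁻¹.im)²   [actually y + (−K⁻¹.im) since K⁻¹.im = −b/N]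
  -- = (a/N)² + (y + b/N)²
  have hKinv_re : K⁻¹.re = a / (a ^ 2 + b ^ 2) := by rw [inv_re, hnormSq_eq]
  have hKinv_im : K⁻¹.im = -b / (a ^ 2 + b ^ 2) := by rw [inv_im, hnormSq_eq]
  -- The key algebraic identity
  have key_algebra : ‖(y : ℂ) * I - K⁻¹‖ ^ 2 = y ^ 2 + (1 + 2 * y * b) / (a ^ 2 + b ^ 2) := by
    have hnorm_sq : ‖(y : ℂ) * I - K⁻¹‖ ^ 2 = normSq ((y : ℂ) * I - K⁻¹) := by
      rw [normSq_eq_norm_sq]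
    rw [hnorm_sq, normSq_apply]
    simp only [sub_re, sub_im, mul_re, ofReal_re, I_re, ofReal_im, I_im, mul_zero, sub_zero,
               mul_im, mul_one, add_zero]
    rw [hKinv_re, hKinv_im]
    field_simp
    ring
  -- ‖·‖ ≤ y ⟺ ‖·‖² ≤ y² (both ≥ 0)
  have hy_nonneg : (0 : ℝ) ≤ y := le_of_lt hy
  have hsq_equiv : ‖(y : ℂ) * I - K⁻¹‖ ≤ y ↔ ‖(y : ℂ) * I - K⁻¹‖ ^ 2 ≤ y ^ 2 := by
    constructor
    · intro h; exact sq_le_sq' (by linarith [norm_nonneg ((y : ℂ) * I - K⁻¹)]) h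
    · intro h
      have hn := norm_nonneg ((y : ℂ) * I - K⁻¹)
      nlinarith [sq_nonneg (‖(y : ℂ) * I - K⁻¹‖ - y)]
  rw [hsq_equiv, key_algebra]
  -- y² + (1 + 2yb)/(a²+b²) ≤ y² ⟺ (1 + 2yb)/(a²+b²) ≤ 0 ⟺ 1 + 2yb ≤ 0 (since denom > 0)
  rw [add_le_iff_nonpos_right, div_nonpos_iff]
  -- div_nonpos_iff gives: (0 ≤ a ∧ b ≤ 0) ∨ (a ≤ 0 ∧ 0 ≤ b)
  -- Here a = 1 + 2yb, b = a² + b² (confusing notation)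
  -- Since a² + b² > 0, only the second disjunct can hold: 1 + 2yb ≤ 0 ∧ 0 ≤ a² + b²
  have hdenom_nonneg : (0 : ℝ) ≤ a ^ 2 + b ^ 2 := le_of_lt hN_pos
  constructor
  · rintro (⟨_, hdenom_neg⟩ | ⟨h, _⟩)
    · linarith
    · rw [hbrel] at h
      have expand : 1 + 2 * y * (Kext.im - 1 / (2 * y)) = 2 * y * Kext.im := by field_simp; ring
      rw [expand] at h
      nlinarith
  · intro h
    right
    constructor
    · rw [hbrel]
      have expand : 1 + 2 * y * (Kext.im - 1 / (2 * y)) = 2 * y * Kext.im := by field_simp; ring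
      rw [expand]
      nlinarith
    · exact hdenom_nonneg

end RhW08.Lens1
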